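import Summits.ABC.ABC.Theses.DefiniteXi
import Summits.ABC.ABC.Theorems.XiBound.Negative.XiBoundDomainSetup
import Summits.ABC.ABC.Theorems.DefiniteXiEisensteinQuarantineLatticeDepthDvdIff
import Summits.ABC.ABC.Theorems.DefiniteXiEisensteinQuarantineGcdWeightMulDvdTwelve
import Literature.NumberTheory.Automorphic.DefiniteOrderUnitsCardDvd
import Literature.NumberTheory.EllipticCurves.PastenValuationProductTamagawaProofs
import HarnessLib

/-!
# Line `Sketch` (ideator 2: occurrence-depth dictionary) for crux `EisensteinQuarantine`
(stmt-ABC-15023, route `DefiniteXi`) — lead skeleton rev 2 (stubs 1, 2 LANDED and imported)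

Crux (by name): `Summit.ABC.ABC.Theses.DefiniteXi.EisensteinQuarantine` — for every `ε > 0` a `C` with
`sixPart ξ := ordProj[2] ξ · ordProj[3] ξ ≤ C · N^ε · 𝓛` for every Frey curve `E_(a,b)` (`a, b` coprime,
`ab(a+b) ≠ 0`, `N` = conductor), every admissible `N⁻ = Nm` (odd, squarefree, `ω` odd, `Nm ∣ N`),
`ξ = brandtXi (N/Nm) Nm (a_n(E))`, `𝓛 = ∏_{q ∣ N, q ∤ Nm} ord_q Δ_min`.

Line (cards `Cruxes/EisensteinQuarantine/Ideas/weak-occurrence-depth.md` + `hida-weight-anatomy.md`,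
ideator 2; the planner's `Sketch.lean` evidence file is not mounted on this hub, so the skeleton is
rebuilt from the cards): the LATTICE DICTIONARY.  For the primitive generator `φ` of the Frey eigen-line
in the Brandt lattice `ℤ^{Cls O}` with Gross pairing `⟨e_i, e_j⟩ = w_i δ_ij`, `ξ = ⟨φ, φ⟩` and
`d := gcd_i (w_i φ_i)` (`d ∣ 12`):

  `m ∣ ξ / d  ⟺  ∃ ψ ⊥ φ, φ ≡ ψ (mod m)`  (stub 1, pure algebra),

so the `p`-adic depth of `ξ` is the deepest OCCURRENCE of `φ` modulo `p^k` inside the complement lattice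
`φ^⊥` (Eisenstein vector, other `N⁻`-new forms, `N⁺`-old forms).  The crux's `p`-adic half is therefore
EQUIVALENT (up to the factor `ordProj[p] d ≤ 12`) to an OCCURRENCE BOUND: a witness `ψ ⊥ φ`,
`φ ≡ ψ (mod p^k)` forces `p^k ≤ C_ε N^ε · ordProj[p] 𝓛` (stubs 3, 4: the research content — sign lanes
(S), level lanes (L) and the residual Jordan blocks (EisJordan) of the card, packaged at the lattice
level where the censuses measure them).  The 2- and 3-adic halves multiply to the crux because
`ordProj[2] 𝓛 · ordProj[3] 𝓛 ≤ 𝓛` (`𝓛 ≥ 1`: every prime of the conductor divides `Δ_min`).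

Registered stubs:
* stub 1 `stub_latticeDepth_dvd_iff` — the dictionary — LANDED
  `Summit.ABC.ABC.Theorems.stub_latticeDepth_dvd_iff` (DefiniteXiEisensteinQuarantineLatticeDepthDvdIff,
  p96490; wave-1 worker; Bezout via Mathlib's `Finset.gcd_eq_sum_mul`);
* stub 2 `stub_gcdWeightMulDvdTwelve` — `gcd_i (w_i φ_i) ∣ 12` on an eigen-line — LANDED
  `Summit.ABC.ABC.Theorems.stub_gcdWeightMulDvdTwelve` (DefiniteXiEisensteinQuarantineGcdWeightMulDvdTwelve,
  p96673; wave-1 worker; primitivity `exists_sum_mul_eq_one_of_eigenLine` + `Brandt.XiSetup.weight_dvd_twelve`);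
* stub 3 `stub_twoAdicOccurrenceBound` — THE MECHANISM (2-adic occurrence bound; open, L; sorried below);
* stub 4 `stub_threeAdicOccurrenceBound` — the 3-adic occurrence bound (honest residual of the line,
  barrier note B3: generically NOT an Eisenstein quantity; open, L; sorried below).
Calibration (LANDED, p97646, DefiniteXiEisensteinQuarantineThreeAdicCalibration, wave-1 worker):
`Summit.ABC.ABC.Theorems.occurrenceBound_of_ordProjHalf` (the `p`-adic half ⟹ the occurrence bound at
`p`, same `C`) — the converse of `half_of_occurrence` below, so stubs 3/4 are EQUIVALENT to the per-prime
halves of the crux (`C ↦ C`, resp. `C ↦ 12 · max C 1`); `threeAdicOccurrenceBound_of_half` (stub 4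
verbatim from the 3-adic half; registered as a fifth, discharged stub).
Glue (sorry-free): `half_of_occurrence` (dictionary + `d ∣ 12` + occurrence bound at `p` ⟹ the
`p`-adic half with the per-prime allowance `ordProj[p] 𝓛`), `sixPart_of_halves`, and
`EisensteinQuarantine_of` concluding the route decl BY NAME.
-/

-- `Summit.<Summit>.<Problem>`: for the single-conjunct summit `ABC` the duplicate `ABC.ABC` is mandated.
set_option linter.dupNamespace false

noncomputable section

namespace Summit.ABC.ABC.Cruxes.EisensteinQuarantine.Sketch

open scoped BigOperators Classical
open Literature.NumberTheory.Automorphic Literature.NumberTheory.EllipticCurves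
open Summit.ABC.ABC.Theorems.XiBound.Negative

/-! ## Registered stubs

### Discharged stubs (landed under `Summits/ABC/ABC/Theorems/`, imported above)

* stub 1 `stub_latticeDepth_dvd_iff` (`m ∣ (Σ w φ²)/gcd(w φ) ↔ ∃ ψ, Σ w ψ φ = 0 ∧ ∀ i, m ∣ φ i - ψ i`) =
  `Summit.ABC.ABC.Theorems.stub_latticeDepth_dvd_iff` (p96490);
* stub 2 `stub_gcdWeightMulDvdTwelve` (`gcd_i (w_i φ_i) ∣ 12` on an eigen-line) =
  `Summit.ABC.ABC.Theorems.stub_gcdWeightMulDvdTwelve` (p96673).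

### Open stubs -/

/-- **stub 3 — the 2-adic OCCURRENCE BOUND (THE MECHANISM; open, L).**  For every `ε > 0` there is `C`
such that on the crux's domain (Frey curve `E_(a,b)`, conductor `N`, admissible `Nm`, any Brandt setup
`S` of type `(N/Nm, Nm)`, `φ` a generator of the `a(E)`-eigen-line of the Brandt matrices): whenever
`φ ≡ ψ (mod 2^k)` for some `ψ` in the `w`-orthogonal complement of `φ` — i.e. the Frey eigensystem
OCCURS modulo `2^k` in the complement lattice (Eisenstein vector ⊕ other `N⁻`-new forms ⊕ `N⁺`-old
forms) — then `2^k ≤ C · N^ε · ordProj[2] (∏_{q ∣ N, q ∤ Nm} ord_q Δ_min)`.  By stub 1 this is the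
2-adic half of the crux up to the factor `ordProj[2] d ≤ 4`; the card's content is the split of the
depth into sign lanes (S: `(W_q − ε_q)² = −2ε_q (W_q − ε_q)`, `ω(N) + O(1)` bits, absorbed by `N^ε`),
level lanes at `p ∣ N/Nm` (L: Ribet–Takahashi, `v₂(ord_p Δ_min) + O(1)` bits each — the per-prime
allowance `ordProj[2] 𝓛 · 2^{O(ω)}`) and residual Jordan blocks (EisJordan: boundedly many, bounded
exponent).  Census calibration (crux programme kit j012877/j013104, refuter kit j015490/j015502):
residual `ρ = v₂ ξ − ω(N⁻) − v₂(v₂ Δ_min)` is `≤ 3` at maximal `N⁻`, plateaus (`≤ 10`) on semistable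
curves to `N ≤ 1.7·10⁶`, DRIFTS (≈ 0.5–0.65 bit/bit) on additive-at-2 curves (`2⁴ ∥ N`) — the refuter's
repaired scope is `Squarefree N`.
STATUS (lead, cycle 1, `Lines/Sketch.md`): CENSUS-FALSE AS FILED along the semistable family
`freyCurve (−p) (p−1)`, `p ≡ 1 (mod 2^s)`, `Nm = p` (ideator 2, kit j016666: `v₂ deg φ ≥ s − 1`,
11/11, `s ≤ 16`; via Takahashi `v₂ ξ(N/p, p) ≥ s − 8` while the allowance is
`(2s−8)·∏_{q ∣ m} 2 v_q(m) = 2^{o(s)}`, `p − 1 = 2^s m`): the Frey point absorbs the 2-part of Mazur's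
Eisenstein ideal of the QUARANTINED prime.  By the landed calibration this stub is equivalent to the
crux's 2-adic half, so no reshaping inside the line repairs it; the planner of record restates the
crux (the Eisenstein index `∏_{q ∣ Nm}(q ∓ 1)` must join the allowance) — see the lead memo. -/
theorem stub_twoAdicOccurrenceBound :
    ∀ ε : ℝ, 0 < ε → ∃ C : ℝ, ∀ a b : ℤ, IsCoprime a b → a * b * (a + b) ≠ 0 →
      ∀ (N : ℕ) [NeZero N], (freyCurve a b).conductorNorm ℤ = N →
      ∀ Nm : ℕ, Odd Nm → Squarefree Nm → Odd Nm.primeFactors.card → Nm ∣ N →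
      ∀ (S : Brandt.XiSetup (N / Nm) Nm) [Fintype (Brandt.ClassSet S.O)],
        ∀ φ : Brandt.ClassSet S.O → ℤ, φ ≠ 0 →
          Brandt.eigenLattice (N / Nm * Nm) (Brandt.matrix S.O)
              (fun n => (freyCurve a b).LFunction n) = ℤ ∙ φ →
          ∀ (k : ℕ) (ψ : Brandt.ClassSet S.O → ℤ),
            ∑ i, (Brandt.weight S.O i : ℤ) * ψ i * φ i = 0 →
            (∀ i, ((2 ^ k : ℕ) : ℤ) ∣ φ i - ψ i) →
            ((2 ^ k : ℕ) : ℝ) ≤ C * (N : ℝ) ^ ε *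
              ((ordProj[2] (∏ q ∈ N.primeFactors \ Nm.primeFactors,
                ((freyCurve a b).minimalDiscriminantNorm ℤ).factorization q) : ℕ) : ℝ) := by
  sorry

/-- **stub 4 — the 3-adic OCCURRENCE BOUND (honest residual of the line; open, L).**  Same statement at
the prime `3`: an occurrence `φ ≡ ψ (mod 3^k)`, `ψ ⊥ φ`, forces
`3^k ≤ C · N^ε · ordProj[3] (∏_{q ∣ N, q ∤ Nm} ord_q Δ_min)`.  The dictionary (stub 1, `d ∣ 12`) applies
verbatim, but for generic Frey curves `ρ̄_(E,3)` is irreducible (`a₃(E) = 0` whenever `3 ∤ abc`), so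
the 3-part of `ξ` is a Steinberg adjoint-Selmer length at `ℓ = 3`, NOT an Eisenstein quantity (barrier
note B3 of the cards): declared and measured (tail census kit j015785/j015786/j015829/j015830:
3-adic tail sub-geometric, max `3^6` at `N ≤ 4·10⁴`; refuter: `3^5` at `N = 323697`), not claimed.
STATUS (lead, cycle 1): census-disfavoured as filed — 3-adic excesses `3^8 = N^{0.70}` (`E_(1,268)`,
`269 ≡ −1 (mod 27)`) and `3^6` (`E_(16,3109)`) with no `3` in the allowance (ideator 2, final census):
the Eisenstein index `q ∓ 1` of the quarantined prime enters at `3` as it does at `2`. -/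
theorem stub_threeAdicOccurrenceBound :
    ∀ ε : ℝ, 0 < ε → ∃ C : ℝ, ∀ a b : ℤ, IsCoprime a b → a * b * (a + b) ≠ 0 →
      ∀ (N : ℕ) [NeZero N], (freyCurve a b).conductorNorm ℤ = N →
      ∀ Nm : ℕ, Odd Nm → Squarefree Nm → Odd Nm.primeFactors.card → Nm ∣ N →
      ∀ (S : Brandt.XiSetup (N / Nm) Nm) [Fintype (Brandt.ClassSet S.O)],
        ∀ φ : Brandt.ClassSet S.O → ℤ, φ ≠ 0 →
          Brandt.eigenLattice (N / Nm * Nm) (Brandt.matrix S.O)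
              (fun n => (freyCurve a b).LFunction n) = ℤ ∙ φ →
          ∀ (k : ℕ) (ψ : Brandt.ClassSet S.O → ℤ),
            ∑ i, (Brandt.weight S.O i : ℤ) * ψ i * φ i = 0 →
            (∀ i, ((3 ^ k : ℕ) : ℤ) ∣ φ i - ψ i) →
            ((3 ^ k : ℕ) : ℝ) ≤ C * (N : ℝ) ^ ε *
              ((ordProj[3] (∏ q ∈ N.primeFactors \ Nm.primeFactors,
                ((freyCurve a b).minimalDiscriminantNorm ℤ).factorization q) : ℕ) : ℝ) := by
  sorry

/-! ## The reduction (sorry-free) -/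

/-- On the crux's domain every prime `q ∣ N` divides `Δ_min(E_(a,b))`, so the level-lowering content
`𝓛 = ∏_{q ∣ N, q ∤ Nm} ord_q Δ_min` is a positive integer. -/
theorem allowance_ne_zero {a b : ℤ} (h0 : a * b * (a + b) ≠ 0) {N : ℕ}
    (hN : (freyCurve a b).conductorNorm ℤ = N) (s : Finset ℕ) :
    ∏ q ∈ N.primeFactors \ s, ((freyCurve a b).minimalDiscriminantNorm ℤ).factorization q ≠ 0 := by
  haveI := isElliptic_freyCurve h0
  refine Finset.prod_ne_zero_iff.mpr fun q hq => ?_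
  have hq' : q ∈ ((freyCurve a b).minimalDiscriminantNorm ℤ).primeFactors := by
    rw [← primeFactors_conductorNorm_eq (freyCurve a b), hN]
    exact (Finset.mem_sdiff.mp hq).1
  rw [← Nat.support_factorization] at hq'
  exact Finsupp.mem_support_iff.mp hq'

/-- `ordProj[p] m ≤ 12` whenever `m ∣ 12` in `ℤ` (`m ≠ 0` is automatic). -/
theorem ordProj_natAbs_le_twelve {m : ℤ} (hm : m ∣ 12) (p : ℕ) : ordProj[p] m.natAbs ≤ 12 := by
  have h12 : m.natAbs ∣ 12 := by
    have := Int.natAbs_dvd_natAbs.mpr hm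
    simpa using this
  have hm0 : m.natAbs ≠ 0 := fun h => by simp [h] at h12
  exact (Nat.ordProj_le p hm0).trans (Nat.le_of_dvd (by norm_num) h12)

/-- **The `p`-adic half from the dictionary and the occurrence bound at `p`** (the line's transfer,
sorry-free): given stub 1 (`hdict`), stub 2 (`hgcd`) and the occurrence bound at the prime `p`
(`hocc`, the common shape of stubs 3 and 4), for every `ε > 0` there is `C` with
`ordProj[p] ξ ≤ C · N^ε · ordProj[p] 𝓛` on the whole domain of the crux.  Proof: a setup `S` exists on
the domain (`nonempty_xiSetup_freyCurve`) and computes `ξ` (`Brandt.XiSetup.brandtXi_eq_xi`); off an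
eigen-line `ξ = 0` and `ordProj[p] 0 = 1`; on a line `ℤ φ`, `ξ = d · (ξ/d)` with `ordProj[p] d ≤ 12`,
and `p^{v_p(ξ/d)} ∣ ξ/d` yields by the dictionary a witness `ψ ⊥ φ`, `φ ≡ ψ (mod p^{v_p(ξ/d)})`, to
which the occurrence bound applies. -/
theorem half_of_occurrence (p : ℕ)
    (hdict : ∀ {ι : Type} [Fintype ι] (w : ι → ℕ) (φ : ι → ℤ) (m : ℤ),
      m ∣ (∑ i, (w i : ℤ) * φ i ^ 2) / Finset.univ.gcd (fun i => (w i : ℤ) * φ i) ↔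
        ∃ ψ : ι → ℤ, ∑ i, (w i : ℤ) * ψ i * φ i = 0 ∧ ∀ i, m ∣ φ i - ψ i)
    (hgcd : ∀ {Nplus Nminus : ℕ} (S : Brandt.XiSetup Nplus Nminus) (lam : ℕ → ℤ)
      [Fintype (Brandt.ClassSet S.O)],
      ∀ φ : Brandt.ClassSet S.O → ℤ, φ ≠ 0 →
        Brandt.eigenLattice (Nplus * Nminus) (Brandt.matrix S.O) lam = ℤ ∙ φ →
        Finset.univ.gcd (fun i => (Brandt.weight S.O i : ℤ) * φ i) ∣ 12)
    (hocc : ∀ ε : ℝ, 0 < ε → ∃ C : ℝ, ∀ a b : ℤ, IsCoprime a b → a * b * (a + b) ≠ 0 →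
      ∀ (N : ℕ) [NeZero N], (freyCurve a b).conductorNorm ℤ = N →
      ∀ Nm : ℕ, Odd Nm → Squarefree Nm → Odd Nm.primeFactors.card → Nm ∣ N →
      ∀ (S : Brandt.XiSetup (N / Nm) Nm) [Fintype (Brandt.ClassSet S.O)],
        ∀ φ : Brandt.ClassSet S.O → ℤ, φ ≠ 0 →
          Brandt.eigenLattice (N / Nm * Nm) (Brandt.matrix S.O)
              (fun n => (freyCurve a b).LFunction n) = ℤ ∙ φ →
          ∀ (k : ℕ) (ψ : Brandt.ClassSet S.O → ℤ),
            ∑ i, (Brandt.weight S.O i : ℤ) * ψ i * φ i = 0 →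
            (∀ i, ((p ^ k : ℕ) : ℤ) ∣ φ i - ψ i) →
            ((p ^ k : ℕ) : ℝ) ≤ C * (N : ℝ) ^ ε *
              ((ordProj[p] (∏ q ∈ N.primeFactors \ Nm.primeFactors,
                ((freyCurve a b).minimalDiscriminantNorm ℤ).factorization q) : ℕ) : ℝ)) :
    ∀ ε : ℝ, 0 < ε → ∃ C : ℝ, ∀ a b : ℤ, IsCoprime a b → a * b * (a + b) ≠ 0 →
      ∀ (N : ℕ) [NeZero N], (freyCurve a b).conductorNorm ℤ = N →
      ∀ Nm : ℕ, Odd Nm → Squarefree Nm → Odd Nm.primeFactors.card → Nm ∣ N →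
      ((ordProj[p] (brandtXi (N / Nm) Nm (fun n => (freyCurve a b).LFunction n)) : ℕ) : ℝ) ≤
        C * (N : ℝ) ^ ε *
          ((ordProj[p] (∏ q ∈ N.primeFactors \ Nm.primeFactors,
            ((freyCurve a b).minimalDiscriminantNorm ℤ).factorization q) : ℕ) : ℝ) := by
  intro ε hε
  obtain ⟨C, hC⟩ := hocc ε hε
  refine ⟨12 * max C 1, fun a b hab h0 N _ hN Nm hodd hsq hcard hdvd => ?_⟩
  have hN0 : N ≠ 0 := NeZero.ne N
  have hNε : (1 : ℝ) ≤ (N : ℝ) ^ ε :=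
    Real.one_le_rpow (by exact_mod_cast Nat.one_le_iff_ne_zero.mpr hN0) hε.le
  set L : ℕ := ∏ q ∈ N.primeFactors \ Nm.primeFactors,
    ((freyCurve a b).minimalDiscriminantNorm ℤ).factorization q with hLdef
  have hLp : (1 : ℝ) ≤ ((ordProj[p] L : ℕ) : ℝ) := by
    exact_mod_cast Nat.one_le_iff_ne_zero.mpr (Nat.ordProj_pos L p).ne'
  have hK1 : (1 : ℝ) ≤ 12 * max C 1 := by linarith [le_max_right C 1]
  -- the bound available in every degenerate branch (`ordProj[p] 0 = 1`)
  have hdeg : (1 : ℝ) ≤ 12 * max C 1 * (N : ℝ) ^ ε * ((ordProj[p] L : ℕ) : ℝ) :=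
    calc (1 : ℝ) = 1 * 1 * 1 := by ring
      _ ≤ 12 * max C 1 * (N : ℝ) ^ ε * ((ordProj[p] L : ℕ) : ℝ) :=
        mul_le_mul (mul_le_mul hK1 hNε zero_le_one (by positivity)) hLp zero_le_one
          (by positivity)
  -- a Brandt setup of type `(N/Nm, Nm)` exists on the crux's domain and computes `ξ`
  have hne := nonempty_xiSetup_freyCurve hab h0 hodd hsq hcard (by rw [hN]; exact hdvd)
  rw [hN] at hne
  obtain ⟨S⟩ := hne
  letI : Fintype (Brandt.ClassSet S.O) := Fintype.ofFinite _
  rw [S.brandtXi_eq_xi]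
  by_cases hline : ∃ φ : Brandt.ClassSet S.O → ℤ, φ ≠ 0 ∧
      Brandt.eigenLattice (N / Nm * Nm) (Brandt.matrix S.O)
        (fun n => (freyCurve a b).LFunction n) = ℤ ∙ φ
  swap
  · -- off an eigen-line `ξ` is the junk value `0`
    have h0' : S.xi (fun n => (freyCurve a b).LFunction n) = 0 := by
      rw [Brandt.XiSetup.xi, Brandt.xiOfOrder_eq, Brandt.xi_of_not_isLine _ hline]
    rw [h0', Nat.factorization_zero, Finsupp.zero_apply, pow_zero, Nat.cast_one]
    exact hdeg
  obtain ⟨φ, hφ, hLφ⟩ := hline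
  -- notation: `w` the Gross weights, `ξZ = Σ w_i φ_i²`, `d = gcd (w_i φ_i)`, `t = ξZ / d`
  set w : Brandt.ClassSet S.O → ℕ := Brandt.weight S.O with hw
  have hxi : S.xi (fun n => (freyCurve a b).LFunction n) = ∑ i, w i * (φ i).natAbs ^ 2 := by
    rw [Brandt.XiSetup.xi, Brandt.xiOfOrder_eq, Brandt.xi_eq_sum _ hφ hLφ]
  set ξZ : ℤ := ∑ i, (w i : ℤ) * φ i ^ 2 with hξZ
  have hcast : (S.xi (fun n => (freyCurve a b).LFunction n) : ℤ) = ξZ := by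
    rw [hxi, hξZ]
    push_cast
    exact Finset.sum_congr rfl fun i _ => by rw [sq_abs]
  set d : ℤ := Finset.univ.gcd (fun i => (w i : ℤ) * φ i) with hd
  have hd12 : d ∣ 12 := hgcd S _ φ hφ hLφ
  have hd0 : d ≠ 0 := by
    rintro h
    rw [h, zero_dvd_iff] at hd12
    norm_num at hd12
  have hdξ : d ∣ ξZ := by
    refine Finset.dvd_sum fun i _ => ?_
    rw [show (w i : ℤ) * φ i ^ 2 = (w i : ℤ) * φ i * φ i by ring]
    exact (Finset.gcd_dvd (Finset.mem_univ i)).mul_right _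
  set t : ℤ := ξZ / d with ht
  have hξt : ξZ = d * t := (Int.mul_ediv_cancel' hdξ).symm
  -- `ξ ≠ 0` on a line: `w_i ≥ 1` (`w_i ∣ 12`) and `φ ≠ 0`
  have hξpos : 0 < S.xi (fun n => (freyCurve a b).LFunction n) := by
    rw [hxi]
    obtain ⟨i, hi⟩ := Function.ne_iff.mp hφ
    have hwi : 0 < w i := Nat.pos_of_dvd_of_pos (S.weight_dvd_twelve i) (by norm_num)
    exact Finset.sum_pos' (fun _ _ => Nat.zero_le _)
      ⟨i, Finset.mem_univ _, Nat.mul_pos hwi (pow_pos (Int.natAbs_pos.mpr hi) 2)⟩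
  have hξZ0 : ξZ ≠ 0 := by
    rw [← hcast]
    exact_mod_cast hξpos.ne'
  have ht0 : t ≠ 0 := fun h => hξZ0 (by rw [hξt, h, mul_zero])
  -- `k := v_p(t)`; the dictionary turns `p^k ∣ t = ξ/d` into an occurrence witness
  set k : ℕ := t.natAbs.factorization p with hk
  have hpk : ((p ^ k : ℕ) : ℤ) ∣ t := Int.natCast_dvd.mpr (Nat.ordProj_dvd t.natAbs p)
  have hpk' : ((p ^ k : ℕ) : ℤ) ∣
      (∑ i, (w i : ℤ) * φ i ^ 2) / Finset.univ.gcd (fun i => (w i : ℤ) * φ i) := by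
    rw [← hξZ, ← hd, ← ht]
    exact hpk
  obtain ⟨ψ, hψ, hcong⟩ := (hdict w φ ((p ^ k : ℕ) : ℤ)).mp hpk'
  have hbound := hC a b hab h0 N hN Nm hodd hsq hcard hdvd S φ hφ hLφ k ψ hψ hcong
  -- `ordProj[p] ξ = ordProj[p] |d| · ordProj[p] |t| ≤ 12 · p^k`
  have hxi_eq : S.xi (fun n => (freyCurve a b).LFunction n) = d.natAbs * t.natAbs := by
    have h1 : (S.xi (fun n => (freyCurve a b).LFunction n) : ℤ) = d * t := hcast.trans hξt
    have h2 := congrArg Int.natAbs h1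
    rwa [Int.natAbs_natCast, Int.natAbs_mul] at h2
  have hord_le : ordProj[p] (S.xi (fun n => (freyCurve a b).LFunction n)) ≤ 12 * p ^ k := by
    rw [hxi_eq, Nat.ordProj_mul p (Int.natAbs_ne_zero.mpr hd0) (Int.natAbs_ne_zero.mpr ht0)]
    exact Nat.mul_le_mul_right _ (ordProj_natAbs_le_twelve hd12 p)
  calc ((ordProj[p] (S.xi (fun n => (freyCurve a b).LFunction n)) : ℕ) : ℝ)
      ≤ ((12 * p ^ k : ℕ) : ℝ) := by exact_mod_cast hord_le
    _ = 12 * ((p ^ k : ℕ) : ℝ) := by push_cast; ring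
    _ ≤ 12 * (C * (N : ℝ) ^ ε * ((ordProj[p] L : ℕ) : ℝ)) := by gcongr
    _ ≤ 12 * (max C 1 * (N : ℝ) ^ ε * ((ordProj[p] L : ℕ) : ℝ)) := by
        gcongr
        exact le_max_left _ _
    _ = 12 * max C 1 * (N : ℝ) ^ ε * ((ordProj[p] L : ℕ) : ℝ) := by ring

/-- **The two halves multiply to the crux** (sorry-free): per-prime bounds
`ordProj[p] ξ ≤ C_p · N^{ε/2} · ordProj[p] 𝓛` at `p = 2, 3` give
`sixPart ξ ≤ C₂ C₃ · N^ε · ordProj[2] 𝓛 · ordProj[3] 𝓛 ≤ C₂ C₃ · N^ε · 𝓛`, because `𝓛 ≠ 0`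
(`allowance_ne_zero`) and `ordProj[2] 𝓛 · ordProj[3] 𝓛 ∣ 𝓛`.  Stated with the crux unfolded (only
`EisensteinQuarantine_of` concludes the route decl by name). -/
theorem sixPart_of_halves
    (h2 : ∀ ε : ℝ, 0 < ε → ∃ C : ℝ, ∀ a b : ℤ, IsCoprime a b → a * b * (a + b) ≠ 0 →
      ∀ (N : ℕ) [NeZero N], (freyCurve a b).conductorNorm ℤ = N →
      ∀ Nm : ℕ, Odd Nm → Squarefree Nm → Odd Nm.primeFactors.card → Nm ∣ N →
      ((ordProj[2] (brandtXi (N / Nm) Nm (fun n => (freyCurve a b).LFunction n)) : ℕ) : ℝ) ≤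
        C * (N : ℝ) ^ ε *
          ((ordProj[2] (∏ q ∈ N.primeFactors \ Nm.primeFactors,
            ((freyCurve a b).minimalDiscriminantNorm ℤ).factorization q) : ℕ) : ℝ))
    (h3 : ∀ ε : ℝ, 0 < ε → ∃ C : ℝ, ∀ a b : ℤ, IsCoprime a b → a * b * (a + b) ≠ 0 →
      ∀ (N : ℕ) [NeZero N], (freyCurve a b).conductorNorm ℤ = N →
      ∀ Nm : ℕ, Odd Nm → Squarefree Nm → Odd Nm.primeFactors.card → Nm ∣ N →
      ((ordProj[3] (brandtXi (N / Nm) Nm (fun n => (freyCurve a b).LFunction n)) : ℕ) : ℝ) ≤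
        C * (N : ℝ) ^ ε *
          ((ordProj[3] (∏ q ∈ N.primeFactors \ Nm.primeFactors,
            ((freyCurve a b).minimalDiscriminantNorm ℤ).factorization q) : ℕ) : ℝ)) :
    ∀ ε : ℝ, 0 < ε → ∃ C : ℝ, ∀ a b : ℤ, IsCoprime a b → a * b * (a + b) ≠ 0 →
      ∀ (N : ℕ) [NeZero N], (freyCurve a b).conductorNorm ℤ = N →
      ∀ Nm : ℕ, Odd Nm → Squarefree Nm → Odd Nm.primeFactors.card → Nm ∣ N →
      ((ordProj[2] (brandtXi (N / Nm) Nm (fun n => (freyCurve a b).LFunction n)) *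
          ordProj[3] (brandtXi (N / Nm) Nm (fun n => (freyCurve a b).LFunction n)) : ℕ) : ℝ) ≤
        C * (N : ℝ) ^ ε *
          ((∏ q ∈ N.primeFactors \ Nm.primeFactors,
            ((freyCurve a b).minimalDiscriminantNorm ℤ).factorization q : ℕ) : ℝ) := by
  intro ε hε
  obtain ⟨C₂, hC₂⟩ := h2 (ε / 2) (half_pos hε)
  obtain ⟨C₃, hC₃⟩ := h3 (ε / 2) (half_pos hε)
  refine ⟨max C₂ 0 * max C₃ 0, fun a b hab h0 N _ hN Nm hodd hsq hcard hdvd => ?_⟩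
  have hN0 : N ≠ 0 := NeZero.ne N
  have hNpos : (0 : ℝ) < N := by exact_mod_cast Nat.pos_of_ne_zero hN0
  set L : ℕ := ∏ q ∈ N.primeFactors \ Nm.primeFactors,
    ((freyCurve a b).minimalDiscriminantNorm ℤ).factorization q with hLdef
  set ξ : ℕ := brandtXi (N / Nm) Nm (fun n => (freyCurve a b).LFunction n) with hξdef
  have hL0 : L ≠ 0 := allowance_ne_zero h0 hN _
  have h2' : ((ordProj[2] ξ : ℕ) : ℝ) ≤ max C₂ 0 * (N : ℝ) ^ (ε / 2) * ((ordProj[2] L : ℕ) : ℝ) :=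
    (hC₂ a b hab h0 N hN Nm hodd hsq hcard hdvd).trans (by gcongr; exact le_max_left _ _)
  have h3' : ((ordProj[3] ξ : ℕ) : ℝ) ≤ max C₃ 0 * (N : ℝ) ^ (ε / 2) * ((ordProj[3] L : ℕ) : ℝ) :=
    (hC₃ a b hab h0 N hN Nm hodd hsq hcard hdvd).trans (by gcongr; exact le_max_left _ _)
  have h23 : ordProj[2] L * ordProj[3] L ≤ L :=
    Nat.le_of_dvd (Nat.pos_of_ne_zero hL0)
      (Nat.Coprime.mul_dvd_of_dvd_of_dvd (Nat.Coprime.pow _ _ (by norm_num))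
        (Nat.ordProj_dvd L 2) (Nat.ordProj_dvd L 3))
  calc ((ordProj[2] ξ * ordProj[3] ξ : ℕ) : ℝ)
      = ((ordProj[2] ξ : ℕ) : ℝ) * ((ordProj[3] ξ : ℕ) : ℝ) := by push_cast; ring
    _ ≤ (max C₂ 0 * (N : ℝ) ^ (ε / 2) * ((ordProj[2] L : ℕ) : ℝ)) *
          (max C₃ 0 * (N : ℝ) ^ (ε / 2) * ((ordProj[3] L : ℕ) : ℝ)) :=
        mul_le_mul h2' h3' (by positivity) (by positivity)
    _ = max C₂ 0 * max C₃ 0 * ((N : ℝ) ^ (ε / 2) * (N : ℝ) ^ (ε / 2)) *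
          ((ordProj[2] L * ordProj[3] L : ℕ) : ℝ) := by push_cast; ring
    _ = max C₂ 0 * max C₃ 0 * (N : ℝ) ^ ε * ((ordProj[2] L * ordProj[3] L : ℕ) : ℝ) := by
        rw [← Real.rpow_add hNpos, add_halves]
    _ ≤ max C₂ 0 * max C₃ 0 * (N : ℝ) ^ ε * (L : ℝ) := by
        have h23' : ((ordProj[2] L * ordProj[3] L : ℕ) : ℝ) ≤ (L : ℝ) := by exact_mod_cast h23
        gcongr

/-- **Skeleton theorem**: the crux BY NAME from the registered stubs — the dictionary (stub 1) and
`d ∣ 12` (stub 2) turn the occurrence bounds at `2` (stub 3, the mechanism) and at `3` (stub 4, the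
residual) into the two per-prime halves (`half_of_occurrence`), which multiply to the crux
(`sixPart_of_halves`). -/
theorem EisensteinQuarantine_of : Summit.ABC.ABC.Theses.DefiniteXi.EisensteinQuarantine :=
  sixPart_of_halves
    (half_of_occurrence 2 Summit.ABC.ABC.Theorems.stub_latticeDepth_dvd_iff
      Summit.ABC.ABC.Theorems.stub_gcdWeightMulDvdTwelve stub_twoAdicOccurrenceBound)
    (half_of_occurrence 3 Summit.ABC.ABC.Theorems.stub_latticeDepth_dvd_iff
      Summit.ABC.ABC.Theorems.stub_gcdWeightMulDvdTwelve stub_threeAdicOccurrenceBound)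

end Summit.ABC.ABC.Cruxes.EisensteinQuarantine.Sketch

end
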